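import Summits.QuantumFields.YangMills.Theorems.SwapVirialDeficitZeroModeGroupThreeSmallBallScaling
import Summits.QuantumFields.YangMills.Theorems.SwapVirialDeficitZeroModeGroupThreeSmallBallLimitSet
import Summits.QuantumFields.YangMills.Theorems.SwapVirialDeficitZeroModeGroupThreePointwise
import Summits.QuantumFields.YangMills.Theorems.SwapVirialDeficitSigmaTwistedLetterCeilingHaar
import HarnessLib

/-!
# Exact zero-mode rung Z4 in SMALL-BALL form, three letters — IV: domination by w2's dominator and dominated convergence:
# `Haar³(N₃(t))/t⁴ → v₃′ ∈ (0, ∞)` (modulo the dominator's integrability, part V of w2 g55's Laplace chain)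
# (LEAD ym-line-sfw-p2 g93 07:46Z «EXACT small-ball asymptotics `Haar³{N₃(t)} = v₃t⁴(1+O(t^θ))`»; free-hands support of ⟨stmt-QuantumFields-24197⟩)

* §7 ★ `indicator_rescaledSet_le_dominator` — on the event `4a_I²|x_⊥|², 4a_I²|y_⊥|², 4P < 1`, so `𝟙_{G_s(a)} ≤ e³·dominator a_I` (w2 g55's
  β-free Gaussian ✓`ZeroModeGroup.dominator`) for `s ≥ 0`, `‖a‖ ≤ 1`; §8–§9 Tonelli to ONE lintegral over `cone ⊗ (vol ⊗ vol)` and ★★ `tendsto_tripleIntegral`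
  (dominated convergence along `𝓝[>] 0`: a.e. limit from part III, domination §7, finiteness = the HYPOTHESIS `hV` = w2 g55's part V);
* §10 ★★★ `tendsto_haar_tripleBall_div_pow_four` — `Haar³(N₃(t))/t⁴ → v₃′ = coneConst²·∫dcone(a) vol⊗vol(G₀(re a + ‖Im a‖·i))`, ★ `smallBallConst_pos`
  (`v₃′ > 0`: the limit event contains an open box); §11 the same with `hV` in iterated form, ★★★ `exists_smallBall_three_limit`.
HONEST LABEL: finite-dimensional measure theory (plan-level zero-mode rung of a DRAFT line), CONDITIONAL on the integrability `hV` of w2's dominator;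
NOT the fixed-`L` sharp law of `F^S`, NOT ⟨24197⟩; the Yang–Mills mass gap is NOT proved; no summit is proved by a line.  Seat ym-line-fcl-p3 g44,
`--supports stmt-QuantumFields-24197`.  THEOREMS ONLY, standard axioms.  References: [cite: GonzalezarroyoAltes1988]; [cite: Vanbaal2001]; [folklore].
-/

set_option autoImplicit false

noncomputable section

open MeasureTheory Quaternion Set Filter Topology
open scoped Quaternion ENNReal BigOperators Topology
open Literature.MathematicalPhysics.QuantumLattice
open Literature.MathematicalPhysics.QuantumFieldTheory (haarProbability)
open Summit.QuantumFields.YangMills.Theorems.SwapTwistDeficit.ToronLog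

attribute [local instance] Literature.Analysis.FluidPDE.Tao2016.quatMeasurableSpace
  Literature.Analysis.FluidPDE.Tao2016.quatBorelSpace
  Literature.MathematicalPhysics.QuantumLattice.secondCountableTopology_su2

namespace Summit.QuantumFields.YangMills.Theorems.SwapVirialDeficit.ZeroModeGroup

/-! ## §7 Domination by `e³ ·` w2's dominator -/

/-- ★ **Domination**: for `s ≥ 0` and a hub with `‖a‖ ≤ 1`, `𝟙_{rescaledSet s a}(x, y) ≤ e³ · dominator a_I x y` — on the event
`4a_I²(x_J²+x_K²) ≤ N_s(x)‖a‖² < 1`, the same for `y`, and `4P ≤ N_s(x)N_s(y) < 1`, so the dominator's exponent is `< 3`. [folklore] -/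
theorem indicator_rescaledSet_le_dominator {s : ℝ} (hs : 0 ≤ s) {a : ℍ} (ha : ‖a‖ ≤ 1) (x y : ℍ) :
    (rescaledSet s a).indicator (1 : ℍ × ℍ → ℝ≥0∞) (x, y) ≤ ENNReal.ofReal (Real.exp 3) * dominator a.imI x y := by
  by_cases h : (x, y) ∈ rescaledSet s a
  · rw [Set.indicator_of_mem h, Pi.one_apply]
    obtain ⟨hNx, hNy, hcx, hcy, hcp⟩ := h
    simp only at hNx hNy hcx hcy hcp
    have hx0 : x.re ^ 2 + x.imI ^ 2 < 1 := by
      have : x.re ^ 2 + x.imI ^ 2 ≤ dilNormSq s x := by unfold dilNormSq; nlinarith [sq_nonneg x.imJ, sq_nonneg x.imK]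
      linarith
    have hy0 : y.re ^ 2 + y.imI ^ 2 < 1 := by
      have : y.re ^ 2 + y.imI ^ 2 ≤ dilNormSq s y := by unfold dilNormSq; nlinarith [sq_nonneg y.imJ, sq_nonneg y.imK]
      linarith
    have hNx0 : 0 ≤ dilNormSq s x := dilNormSq_nonneg hs x
    have hNy0 : 0 ≤ dilNormSq s y := dilNormSq_nonneg hs y
    have ha2 : ‖a‖ ^ 2 ≤ 1 := by nlinarith [norm_nonneg a]
    have h1 : 4 * (a.imI ^ 2 * (x.imJ ^ 2 + x.imK ^ 2)) < 1 := by
      calc 4 * (a.imI ^ 2 * (x.imJ ^ 2 + x.imK ^ 2)) ≤ dilNormSq s x * ‖a‖ ^ 2 := hcx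
        _ < 1 := by nlinarith [sq_nonneg ‖a‖]
    have h2 : 4 * (a.imI ^ 2 * (y.imJ ^ 2 + y.imK ^ 2)) < 1 := by
      calc 4 * (a.imI ^ 2 * (y.imJ ^ 2 + y.imK ^ 2)) ≤ dilNormSq s y * ‖a‖ ^ 2 := hcy
        _ < 1 := by nlinarith [sq_nonneg ‖a‖]
    have h3 : 4 * ((x.imK * y.imI - x.imI * y.imK) ^ 2 + (x.imI * y.imJ - x.imJ * y.imI) ^ 2) < 1 := by
      have hQ : 0 ≤ s * (x.imJ * y.imK - x.imK * y.imJ) ^ 2 := by positivity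
      calc 4 * ((x.imK * y.imI - x.imI * y.imK) ^ 2 + (x.imI * y.imJ - x.imJ * y.imI) ^ 2)
          ≤ 4 * ((x.imK * y.imI - x.imI * y.imK) ^ 2 + (x.imI * y.imJ - x.imJ * y.imI) ^ 2 + s * (x.imJ * y.imK - x.imK * y.imJ) ^ 2) := by
            nlinarith
        _ ≤ dilNormSq s x * dilNormSq s y := hcp
        _ < 1 := by nlinarith
    -- the dominator at `(x, y)`: both disc indicators are `1`, the exponent is `> -3`
    rw [dominator_def, Set.indicator_of_mem (show x ∈ {x : ℍ | x.re ^ 2 + x.imI ^ 2 < 1} from hx0),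
      Set.indicator_of_mem (show y ∈ {y : ℍ | y.re ^ 2 + y.imI ^ 2 < 1} from hy0), one_mul, one_mul, ← ENNReal.ofReal_mul (Real.exp_pos _).le,
      ← Real.exp_add]
    rw [← ENNReal.ofReal_one]
    refine ENNReal.ofReal_le_ofReal (Real.one_le_exp_iff.2 ?_)
    nlinarith
  · rw [Set.indicator_of_notMem h]
    exact bot_le

/-! ## §8 The hub constants: `axisPoint` data -/

/-- `(axisPoint a).imI = ‖Im a‖` and `‖axisPoint a‖ = ‖a‖`. [folklore] -/
theorem norm_axisPoint (a : ℍ) : ‖axisPoint a‖ = ‖a‖ := by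
  have h1 : ‖axisPoint a‖ ^ 2 = ‖a‖ ^ 2 := by
    have him := Summit.QuantumFields.YangMills.Theorems.ToronValleyVolume.NearlyCommutingCeiling.sq_norm_im_eq a
    rw [sq (‖axisPoint a‖), ← Quaternion.normSq_eq_norm_mul_self, Quaternion.normSq_def']
    simp only [axisPoint]
    nlinarith [him]
  exact (pow_left_inj₀ (norm_nonneg _) (norm_nonneg _) two_ne_zero).1 h1

/-! ## §8–§9 Dominated convergence for the triple integral -/

/-- The rescaled indicator as a function on the triple space `ℍ × (ℍ × ℍ)` (hub first) is measurable, for every `s`. [folklore] -/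
theorem measurable_tripleIndicator (s : ℝ) :
    Measurable fun q : ℍ × ℍ × ℍ => (rescaledSet s (axisPoint q.1)).indicator (1 : ℍ × ℍ → ℝ≥0∞) (q.2.1, q.2.2) := by
  have e : (fun q : ℍ × ℍ × ℍ => (rescaledSet s (axisPoint q.1)).indicator (1 : ℍ × ℍ → ℝ≥0∞) (q.2.1, q.2.2)) =
      {q : ℍ × ℍ × ℍ | (q.2.1, q.2.2) ∈ rescaledSet s (axisPoint q.1)}.indicator 1 := by
    funext q; rfl
  rw [e]
  exact measurable_one.indicator (measurableSet_rescaledSet_axis_joint s)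

/-- The iterated triple integral equals the integral over the product measure `cone ⊗ (vol ⊗ vol)`. [folklore] -/
theorem tripleIntegral_eq_lintegral_prod (s : ℝ) :
    ∫⁻ a, (∫⁻ x, ∫⁻ y, (rescaledSet s (axisPoint a)).indicator (1 : ℍ × ℍ → ℝ≥0∞) (x, y)) ∂coneMeasure =
      ∫⁻ q, (rescaledSet s (axisPoint q.1)).indicator (1 : ℍ × ℍ → ℝ≥0∞) (q.2.1, q.2.2)
        ∂(coneMeasure.prod ((volume : Measure ℍ).prod (volume : Measure ℍ))) := by
  haveI := isProbabilityMeasure_coneMeasure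
  rw [lintegral_prod _ (measurable_tripleIndicator s).aemeasurable]
  refine lintegral_congr fun a => ?_
  have hH : Measurable fun p : ℍ × ℍ => (rescaledSet s (axisPoint a)).indicator (1 : ℍ × ℍ → ℝ≥0∞) p :=
    measurable_one.indicator (measurableSet_rescaledSet s _)
  rw [lintegral_prod _ hH.aemeasurable]

/-- The «good» set (hub `a ≠ 0` and the five non-degeneracy conditions at `(axisPoint a, x, y)`) is measurable. [folklore] -/
theorem measurableSet_good :
    MeasurableSet {q : ℍ × ℍ × ℍ | q.1 ≠ 0 ∧ (dilNormSq 0 q.2.1 ≠ 1 ∧ dilNormSq 0 q.2.2 ≠ 1 ∧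
      4 * ((axisPoint q.1).imI ^ 2 * (q.2.1.imJ ^ 2 + q.2.1.imK ^ 2)) ≠ dilNormSq 0 q.2.1 * ‖axisPoint q.1‖ ^ 2 ∧
      4 * ((axisPoint q.1).imI ^ 2 * (q.2.2.imJ ^ 2 + q.2.2.imK ^ 2)) ≠ dilNormSq 0 q.2.2 * ‖axisPoint q.1‖ ^ 2 ∧
      4 * ((q.2.1.imK * q.2.2.imI - q.2.1.imI * q.2.2.imK) ^ 2 + (q.2.1.imI * q.2.2.imJ - q.2.1.imJ * q.2.2.imI) ^ 2) ≠
        dilNormSq 0 q.2.1 * dilNormSq 0 q.2.2)} := by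
  have hx : Measurable fun q : ℍ × ℍ × ℍ => q.2.1 := measurable_fst.comp measurable_snd
  have hy : Measurable fun q : ℍ × ℍ × ℍ => q.2.2 := measurable_snd.comp measurable_snd
  have hN1 : Measurable fun q : ℍ × ℍ × ℍ => dilNormSq 0 q.2.1 := (continuous_dilNormSq 0).measurable.comp hx
  have hN2 : Measurable fun q : ℍ × ℍ × ℍ => dilNormSq 0 q.2.2 := (continuous_dilNormSq 0).measurable.comp hy
  have hm : Measurable fun q : ℍ × ℍ × ℍ => (axisPoint q.1).imI := by
    have : (fun q : ℍ × ℍ × ℍ => (axisPoint q.1).imI) = fun q => ‖q.1.im‖ := rfl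
    rw [this]; exact (continuous_norm.comp (Quaternion.continuous_im.comp continuous_fst)).measurable
  have hna : Measurable fun q : ℍ × ℍ × ℍ => ‖axisPoint q.1‖ ^ 2 := by
    have : (fun q : ℍ × ℍ × ℍ => ‖axisPoint q.1‖ ^ 2) = fun q => ‖q.1‖ ^ 2 := by funext q; rw [norm_axisPoint]
    rw [this]; exact (continuous_norm.comp continuous_fst).measurable.pow_const 2
  have hI1 : Measurable fun q : ℍ × ℍ × ℍ => q.2.1.imI := Quaternion.continuous_imI.measurable.comp hx
  have hJ1 : Measurable fun q : ℍ × ℍ × ℍ => q.2.1.imJ := Quaternion.continuous_imJ.measurable.comp hx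
  have hK1 : Measurable fun q : ℍ × ℍ × ℍ => q.2.1.imK := Quaternion.continuous_imK.measurable.comp hx
  have hI2 : Measurable fun q : ℍ × ℍ × ℍ => q.2.2.imI := Quaternion.continuous_imI.measurable.comp hy
  have hJ2 : Measurable fun q : ℍ × ℍ × ℍ => q.2.2.imJ := Quaternion.continuous_imJ.measurable.comp hy
  have hK2 : Measurable fun q : ℍ × ℍ × ℍ => q.2.2.imK := Quaternion.continuous_imK.measurable.comp hy
  have hc1 : Measurable fun q : ℍ × ℍ × ℍ => 4 * ((axisPoint q.1).imI ^ 2 * (q.2.1.imJ ^ 2 + q.2.1.imK ^ 2)) :=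
    (((hm.pow_const 2).mul ((hJ1.pow_const 2).add (hK1.pow_const 2))).const_mul _)
  have hc2 : Measurable fun q : ℍ × ℍ × ℍ => 4 * ((axisPoint q.1).imI ^ 2 * (q.2.2.imJ ^ 2 + q.2.2.imK ^ 2)) :=
    (((hm.pow_const 2).mul ((hJ2.pow_const 2).add (hK2.pow_const 2))).const_mul _)
  have hc3 : Measurable fun q : ℍ × ℍ × ℍ => 4 * ((q.2.1.imK * q.2.2.imI - q.2.1.imI * q.2.2.imK) ^ 2 +
      (q.2.1.imI * q.2.2.imJ - q.2.1.imJ * q.2.2.imI) ^ 2) :=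
    ((((hK1.mul hI2).sub (hI1.mul hK2)).pow_const 2).add (((hI1.mul hJ2).sub (hJ1.mul hI2)).pow_const 2)).const_mul _
  refine (measurableSet_eq_fun measurable_fst measurable_const).compl.inter ((measurableSet_eq_fun hN1 measurable_const).compl.inter
    ((measurableSet_eq_fun hN2 measurable_const).compl.inter ((measurableSet_eq_fun hc1 (hN1.mul hna)).compl.inter
      ((measurableSet_eq_fun hc2 (hN2.mul hna)).compl.inter (measurableSet_eq_fun hc3 (hN1.mul hN2)).compl))))

/-- Almost every point of `cone ⊗ (vol ⊗ vol)` is good. [folklore] -/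
theorem ae_good :
    ∀ᵐ q : ℍ × ℍ × ℍ ∂(coneMeasure.prod ((volume : Measure ℍ).prod (volume : Measure ℍ))),
      q.1 ≠ 0 ∧ (dilNormSq 0 q.2.1 ≠ 1 ∧ dilNormSq 0 q.2.2 ≠ 1 ∧
      4 * ((axisPoint q.1).imI ^ 2 * (q.2.1.imJ ^ 2 + q.2.1.imK ^ 2)) ≠ dilNormSq 0 q.2.1 * ‖axisPoint q.1‖ ^ 2 ∧
      4 * ((axisPoint q.1).imI ^ 2 * (q.2.2.imJ ^ 2 + q.2.2.imK ^ 2)) ≠ dilNormSq 0 q.2.2 * ‖axisPoint q.1‖ ^ 2 ∧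
      4 * ((q.2.1.imK * q.2.2.imI - q.2.1.imI * q.2.2.imK) ^ 2 + (q.2.1.imI * q.2.2.imJ - q.2.1.imJ * q.2.2.imI) ^ 2) ≠
        dilNormSq 0 q.2.1 * dilNormSq 0 q.2.2) := by
  haveI := isProbabilityMeasure_coneMeasure
  refine (Measure.ae_prod_mem_iff_ae_ae_mem measurableSet_good).2 ?_
  have ha0 : ∀ᵐ a : ℍ ∂coneMeasure, a ≠ 0 := by
    rw [ae_iff]
    have e : {a : ℍ | ¬a ≠ 0} = {0} := by ext a; simp
    rw [e]; exact coneMeasure_singleton_zero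
  filter_upwards [ha0] with a ha
  have hna : ‖axisPoint a‖ ≠ 0 := by rw [norm_axisPoint]; exact norm_ne_zero_iff.2 ha
  filter_upwards [ae_not_boundary hna] with p hp
  exact ⟨ha, hp⟩

/-- Domination holds for cone-a.e. hub (hubs in the unit ball) and every `s ≥ 0`. [folklore] -/
theorem ae_indicator_le_dominator {s : ℝ} (hs : 0 ≤ s) :
    ∀ᵐ q : ℍ × ℍ × ℍ ∂(coneMeasure.prod ((volume : Measure ℍ).prod (volume : Measure ℍ))),
      (rescaledSet s (axisPoint q.1)).indicator (1 : ℍ × ℍ → ℝ≥0∞) (q.2.1, q.2.2) ≤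
        ENNReal.ofReal (Real.exp 3) * dominator ‖q.1.im‖ q.2.1 q.2.2 := by
  haveI := isProbabilityMeasure_coneMeasure
  have hball : ∀ᵐ a : ℍ ∂coneMeasure, ‖a‖ < 1 := by
    rw [ae_iff]
    have e : {a : ℍ | ¬‖a‖ < 1} = (Metric.ball (0 : ℍ) 1)ᶜ := by ext a; simp
    rw [e]; exact SigmaTwistedCeiling.coneMeasure_compl_ball
  have h1 : ∀ᵐ q : ℍ × ℍ × ℍ ∂(coneMeasure.prod ((volume : Measure ℍ).prod (volume : Measure ℍ))), ‖q.1‖ < 1 :=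
    (Measure.quasiMeasurePreserving_fst).ae (p := fun a : ℍ => ‖a‖ < 1) hball
  filter_upwards [h1] with q hq
  have hle := indicator_rescaledSet_le_dominator hs (a := axisPoint q.1) (by rw [norm_axisPoint]; exact hq.le) q.2.1 q.2.2
  exact hle

/-- ★★ **DOMINATED CONVERGENCE for the triple integral**: if w2 g55's dominator is integrable against `cone ⊗ vol ⊗ vol` (its part V), then
`∫dcone(a)∫∫𝟙_{G_s(axisPoint a)} → ∫dcone(a)∫∫𝟙_{G₀(axisPoint a)}` as `s → 0⁺`. [folklore] -/
theorem tendsto_tripleIntegral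
    (hV : ∫⁻ q, dominator ‖q.1.im‖ q.2.1 q.2.2 ∂(coneMeasure.prod ((volume : Measure ℍ).prod (volume : Measure ℍ))) ≠ ∞) :
    Tendsto (fun s : ℝ => ∫⁻ a, (∫⁻ x, ∫⁻ y, (rescaledSet s (axisPoint a)).indicator (1 : ℍ × ℍ → ℝ≥0∞) (x, y)) ∂coneMeasure)
      (𝓝[>] (0 : ℝ)) (𝓝 (∫⁻ a, (∫⁻ x, ∫⁻ y, (rescaledSet 0 (axisPoint a)).indicator (1 : ℍ × ℍ → ℝ≥0∞) (x, y)) ∂coneMeasure)) := by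
  haveI := isProbabilityMeasure_coneMeasure
  simp_rw [tripleIntegral_eq_lintegral_prod]
  refine tendsto_lintegral_filter_of_dominated_convergence (fun q => ENNReal.ofReal (Real.exp 3) * dominator ‖q.1.im‖ q.2.1 q.2.2)
    (Eventually.of_forall fun s => measurable_tripleIndicator s) ?_ ?_ ?_
  · -- domination, for `s > 0`
    filter_upwards [self_mem_nhdsWithin] with s hs
    exact ae_indicator_le_dominator (le_of_lt hs)
  · -- finiteness
    rw [lintegral_const_mul' _ _ ENNReal.ofReal_ne_top]
    exact ENNReal.mul_ne_top ENNReal.ofReal_ne_top hV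
  · -- pointwise limit off the null boundary
    filter_upwards [ae_good] with q hq
    exact tendsto_indicator_rescaledSet (axisPoint q.1) q.2.1 q.2.2 hq.2.1 hq.2.2.1 hq.2.2.2.1 hq.2.2.2.2.1 hq.2.2.2.2.2

/-- The limit integral is finite (under `hV`). [folklore] -/
theorem tripleIntegral_zero_ne_top
    (hV : ∫⁻ q, dominator ‖q.1.im‖ q.2.1 q.2.2 ∂(coneMeasure.prod ((volume : Measure ℍ).prod (volume : Measure ℍ))) ≠ ∞) :
    ∫⁻ a, (∫⁻ x, ∫⁻ y, (rescaledSet 0 (axisPoint a)).indicator (1 : ℍ × ℍ → ℝ≥0∞) (x, y)) ∂coneMeasure ≠ ∞ := by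
  haveI := isProbabilityMeasure_coneMeasure
  rw [tripleIntegral_eq_lintegral_prod]
  refine ne_top_of_le_ne_top (ENNReal.mul_ne_top (ENNReal.ofReal_ne_top (r := Real.exp 3)) hV) ?_
  rw [← lintegral_const_mul' _ _ ENNReal.ofReal_ne_top]
  exact lintegral_mono_ae (ae_indicator_le_dominator le_rfl)

/-! ## §10 The small-ball limit -/

/-- ★★★ **THE SMALL-BALL LIMIT OF THE THREE-LETTER COMMUTATOR BALL** (modulo the integrability `hV` of w2 g55's dominator):
`Haar³(N₃(t)) / t⁴ → v₃′` as `t → 0⁺`, with the EXPLICIT cone integral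
`v₃′ = coneConst²·∫dcone(a) (vol⊗vol)(G₀(re a + ‖Im a‖·i))`, `G₀ = rescaledSet 0`. [cite: GonzalezarroyoAltes1988] [cite: Vanbaal2001] -/
theorem tendsto_haar_tripleBall_div_pow_four
    (hV : ∫⁻ q, dominator ‖q.1.im‖ q.2.1 q.2.2 ∂(coneMeasure.prod ((volume : Measure ℍ).prod (volume : Measure ℍ))) ≠ ∞) :
    Tendsto (fun t : ℝ => ((Measure.pi fun _ : Fin 3 => haarProbability (Matrix.specialUnitaryGroup (Fin 2) ℂ)) (tripleBall t)).toReal / t ^ 4)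
      (𝓝[>] (0 : ℝ))
      (𝓝 (ENNReal.ofReal coneConst * (ENNReal.ofReal coneConst *
        ∫⁻ a, (∫⁻ x, ∫⁻ y, (rescaledSet 0 (axisPoint a)).indicator (1 : ℍ × ℍ → ℝ≥0∞) (x, y)) ∂coneMeasure)).toReal) := by
  -- the quotient is `(c² I(t²)).toReal` for `t > 0`
  have hq : ∀ t : ℝ, 0 < t →
      ((Measure.pi fun _ : Fin 3 => haarProbability (Matrix.specialUnitaryGroup (Fin 2) ℂ)) (tripleBall t)).toReal / t ^ 4 =
        (ENNReal.ofReal coneConst * (ENNReal.ofReal coneConst *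
          ∫⁻ a, (∫⁻ x, ∫⁻ y, (rescaledSet (t ^ 2) (axisPoint a)).indicator (1 : ℍ × ℍ → ℝ≥0∞) (x, y)) ∂coneMeasure)).toReal := by
    intro t ht
    have ht4 : (0 : ℝ) < t ^ 4 := by positivity
    rw [haar_tripleBall_eq_scaled ht, ENNReal.toReal_mul, ENNReal.toReal_ofReal ht4.le, mul_div_cancel_left₀ _ ht4.ne']
  -- `s = t² → 0⁺`
  have hsq : Tendsto (fun t : ℝ => t ^ 2) (𝓝[>] (0 : ℝ)) (𝓝[>] (0 : ℝ)) := by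
    refine tendsto_nhdsWithin_iff.2 ⟨?_, ?_⟩
    · have h := ((continuous_pow 2).tendsto (0 : ℝ)).mono_left (nhdsWithin_le_nhds (s := Set.Ioi (0 : ℝ)))
      simpa using h
    · filter_upwards [self_mem_nhdsWithin] with t ht
      have ht' : (0 : ℝ) < t := ht
      exact Set.mem_Ioi.2 (by positivity)
  have hlim : Tendsto (fun t : ℝ => ENNReal.ofReal coneConst * (ENNReal.ofReal coneConst *
      ∫⁻ a, (∫⁻ x, ∫⁻ y, (rescaledSet (t ^ 2) (axisPoint a)).indicator (1 : ℍ × ℍ → ℝ≥0∞) (x, y)) ∂coneMeasure)) (𝓝[>] (0 : ℝ))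
      (𝓝 (ENNReal.ofReal coneConst * (ENNReal.ofReal coneConst *
        ∫⁻ a, (∫⁻ x, ∫⁻ y, (rescaledSet 0 (axisPoint a)).indicator (1 : ℍ × ℍ → ℝ≥0∞) (x, y)) ∂coneMeasure))) := by
    have h1 := (tendsto_tripleIntegral hV).comp hsq
    exact ENNReal.Tendsto.const_mul (ENNReal.Tendsto.const_mul h1 (Or.inr ENNReal.ofReal_ne_top)) (Or.inr ENNReal.ofReal_ne_top)
  have hfin : ENNReal.ofReal coneConst * (ENNReal.ofReal coneConst *
      ∫⁻ a, (∫⁻ x, ∫⁻ y, (rescaledSet 0 (axisPoint a)).indicator (1 : ℍ × ℍ → ℝ≥0∞) (x, y)) ∂coneMeasure) ≠ ∞ :=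
    ENNReal.mul_ne_top ENNReal.ofReal_ne_top (ENNReal.mul_ne_top ENNReal.ofReal_ne_top (tripleIntegral_zero_ne_top hV))
  have hreal := (ENNReal.tendsto_toReal hfin).comp hlim
  refine (tendsto_congr' ?_).2 hreal
  filter_upwards [self_mem_nhdsWithin] with t ht
  exact hq t ht

/-- A box on which the limit constraints hold strictly: `¼ < x₀² + x_I² < 1`, `x_J² + x_K² < 1/1024` for both letters, any hub in the closed
unit ball. [folklore] -/
theorem box_subset_rescaledSet_zero {a : ℍ} (ha : ‖a‖ ≤ 1) {x y : ℍ}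
    (hx1 : 1 / 4 < x.re ^ 2 + x.imI ^ 2) (hx2 : x.re ^ 2 + x.imI ^ 2 < 1) (hx3 : x.imJ ^ 2 + x.imK ^ 2 < 1 / 1024)
    (hy1 : 1 / 4 < y.re ^ 2 + y.imI ^ 2) (hy2 : y.re ^ 2 + y.imI ^ 2 < 1) (hy3 : y.imJ ^ 2 + y.imK ^ 2 < 1 / 1024) :
    (x, y) ∈ rescaledSet 0 a := by
  have him : a.imI ^ 2 ≤ ‖a‖ ^ 2 := by
    rw [sq_norm_eq_sum_sq]; nlinarith [sq_nonneg a.re, sq_nonneg a.imJ, sq_nonneg a.imK]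
  have ha2 : ‖a‖ ^ 2 ≤ 1 := by nlinarith [norm_nonneg a]
  simp only [rescaledSet, Set.mem_setOf_eq, dilNormSq_zero, zero_mul, add_zero]
  refine ⟨hx2, hy2, ?_, ?_, ?_⟩
  · nlinarith [sq_nonneg a.imI, sq_nonneg ‖a‖]
  · nlinarith [sq_nonneg a.imI, sq_nonneg ‖a‖]
  · -- `4|x_I y_⊥ − y_I x_⊥|² ≤ 4(|y_⊥| + |x_⊥|)² ≤ 1/64 < 1/16 < N N`
    have hxI : x.imI ^ 2 ≤ 1 := by nlinarith [sq_nonneg x.re]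
    have hyI : y.imI ^ 2 ≤ 1 := by nlinarith [sq_nonneg y.re]
    have e1 : (x.imK * y.imI - x.imI * y.imK) ^ 2 ≤ 2 * (x.imK ^ 2 * y.imI ^ 2 + x.imI ^ 2 * y.imK ^ 2) := by
      nlinarith [sq_nonneg (x.imK * y.imI + x.imI * y.imK)]
    have e2 : (x.imI * y.imJ - x.imJ * y.imI) ^ 2 ≤ 2 * (x.imI ^ 2 * y.imJ ^ 2 + x.imJ ^ 2 * y.imI ^ 2) := by
      nlinarith [sq_nonneg (x.imI * y.imJ + x.imJ * y.imI)]
    have e3 : x.imK ^ 2 * y.imI ^ 2 ≤ x.imK ^ 2 := by nlinarith [sq_nonneg x.imK]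
    have e4 : x.imI ^ 2 * y.imK ^ 2 ≤ y.imK ^ 2 := by nlinarith [sq_nonneg y.imK]
    have e5 : x.imI ^ 2 * y.imJ ^ 2 ≤ y.imJ ^ 2 := by nlinarith [sq_nonneg y.imJ]
    have e6 : x.imJ ^ 2 * y.imI ^ 2 ≤ x.imJ ^ 2 := by nlinarith [sq_nonneg x.imJ]
    nlinarith

/-- ★ **The limit constant is positive**: `∫dcone(a) (vol⊗vol)(G₀(axisPoint a)) > 0` — the limit event contains an open box. [folklore] -/
theorem tripleIntegral_zero_pos :
    0 < ∫⁻ a, (∫⁻ x, ∫⁻ y, (rescaledSet 0 (axisPoint a)).indicator (1 : ℍ × ℍ → ℝ≥0∞) (x, y)) ∂coneMeasure := by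
  haveI := isProbabilityMeasure_coneMeasure
  set X : Set ℍ := {x | 1 / 4 < x.re ^ 2 + x.imI ^ 2 ∧ x.re ^ 2 + x.imI ^ 2 < 1 ∧ x.imJ ^ 2 + x.imK ^ 2 < 1 / 1024} with hX
  have hN : Continuous fun x : ℍ => x.re ^ 2 + x.imI ^ 2 := (Quaternion.continuous_re.pow 2).add (Quaternion.continuous_imI.pow 2)
  have hT : Continuous fun x : ℍ => x.imJ ^ 2 + x.imK ^ 2 := (Quaternion.continuous_imJ.pow 2).add (Quaternion.continuous_imK.pow 2)
  have hXo : IsOpen X := by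
    rw [hX, Set.setOf_and, Set.setOf_and]
    exact (isOpen_lt continuous_const hN).inter ((isOpen_lt hN continuous_const).inter (isOpen_lt hT continuous_const))
  have hXne : X.Nonempty := ⟨⟨3 / 4, 0, 0, 0⟩, by simp only [hX, Set.mem_setOf_eq]; norm_num⟩
  have hXpos : 0 < (volume : Measure ℍ) X := hXo.measure_pos volume hXne
  have hXm : MeasurableSet X := hXo.measurableSet
  -- lower bound of the inner double integral, for hubs in the closed unit ball
  have hinner : ∀ a : ℍ, ‖a‖ ≤ 1 →
      (volume : Measure ℍ) X * (volume : Measure ℍ) X ≤ ∫⁻ x, ∫⁻ y, (rescaledSet 0 (axisPoint a)).indicator (1 : ℍ × ℍ → ℝ≥0∞) (x, y) := by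
    intro a ha
    have ha' : ‖axisPoint a‖ ≤ 1 := by rw [norm_axisPoint]; exact ha
    calc (volume : Measure ℍ) X * (volume : Measure ℍ) X
        = ∫⁻ x, X.indicator (fun _ => (volume : Measure ℍ) X) x := by rw [lintegral_indicator_const hXm, mul_comm]
      _ = ∫⁻ x, X.indicator (fun _ => ∫⁻ y, X.indicator (1 : ℍ → ℝ≥0∞) y) x := by rw [lintegral_indicator_one hXm]
      _ ≤ ∫⁻ x, ∫⁻ y, (rescaledSet 0 (axisPoint a)).indicator (1 : ℍ × ℍ → ℝ≥0∞) (x, y) := by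
          refine lintegral_mono fun x => ?_
          by_cases hx : x ∈ X
          · rw [Set.indicator_of_mem hx]
            refine lintegral_mono fun y => ?_
            by_cases hy : y ∈ X
            · rw [Set.indicator_of_mem hy, Set.indicator_of_mem (box_subset_rescaledSet_zero ha' hx.1 hx.2.1 hx.2.2 hy.1 hy.2.1 hy.2.2)]
              exact le_rfl
            · rw [Set.indicator_of_notMem hy]; exact bot_le
          · rw [Set.indicator_of_notMem hx]; exact bot_le
  have hball : ∀ᵐ a : ℍ ∂coneMeasure, ‖a‖ < 1 := by
    rw [ae_iff]
    have e : {a : ℍ | ¬‖a‖ < 1} = (Metric.ball (0 : ℍ) 1)ᶜ := by ext a; simp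
    rw [e]; exact SigmaTwistedCeiling.coneMeasure_compl_ball
  have hle : ∫⁻ _a, (volume : Measure ℍ) X * (volume : Measure ℍ) X ∂coneMeasure ≤
      ∫⁻ a, (∫⁻ x, ∫⁻ y, (rescaledSet 0 (axisPoint a)).indicator (1 : ℍ × ℍ → ℝ≥0∞) (x, y)) ∂coneMeasure := by
    refine lintegral_mono_ae ?_
    filter_upwards [hball] with a ha using hinner a ha.le
  refine lt_of_lt_of_le ?_ hle
  rw [lintegral_const, measure_univ, mul_one]
  exact ENNReal.mul_pos hXpos.ne' hXpos.ne'

/-- ★ **`v₃′ > 0`** (under `hV`, which makes it finite and hence a genuine real number). [folklore] -/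
theorem smallBallConst_pos
    (hV : ∫⁻ q, dominator ‖q.1.im‖ q.2.1 q.2.2 ∂(coneMeasure.prod ((volume : Measure ℍ).prod (volume : Measure ℍ))) ≠ ∞) :
    0 < (ENNReal.ofReal coneConst * (ENNReal.ofReal coneConst *
      ∫⁻ a, (∫⁻ x, ∫⁻ y, (rescaledSet 0 (axisPoint a)).indicator (1 : ℍ × ℍ → ℝ≥0∞) (x, y)) ∂coneMeasure)).toReal := by
  have hc : 0 < ENNReal.ofReal coneConst := ENNReal.ofReal_pos.2 coneConst_pos
  refine ENNReal.toReal_pos ?_ ?_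
  · exact (ENNReal.mul_pos hc.ne' (ENNReal.mul_pos hc.ne' tripleIntegral_zero_pos.ne').ne').ne'
  · exact ENNReal.mul_ne_top ENNReal.ofReal_ne_top (ENNReal.mul_ne_top ENNReal.ofReal_ne_top (tripleIntegral_zero_ne_top hV))

/-! ## §11 The integrability hypothesis in iterated form (Tonelli) -/

/-- w2's dominator, as a function on the triple space with the hub's `‖Im a‖` as its rate, is measurable. [folklore] -/
theorem measurable_dominator_triple : Measurable fun q : ℍ × ℍ × ℍ => dominator ‖q.1.im‖ q.2.1 q.2.2 := by
  have hx : Measurable fun q : ℍ × ℍ × ℍ => q.2.1 := measurable_fst.comp measurable_snd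
  have hy : Measurable fun q : ℍ × ℍ × ℍ => q.2.2 := measurable_snd.comp measurable_snd
  have hr : Measurable fun q : ℍ × ℍ × ℍ => ‖q.1.im‖ := (continuous_norm.comp (Quaternion.continuous_im.comp continuous_fst)).measurable
  have hR1 : Measurable fun q : ℍ × ℍ × ℍ => q.2.1.re := Quaternion.continuous_re.measurable.comp hx
  have hI1 : Measurable fun q : ℍ × ℍ × ℍ => q.2.1.imI := Quaternion.continuous_imI.measurable.comp hx
  have hJ1 : Measurable fun q : ℍ × ℍ × ℍ => q.2.1.imJ := Quaternion.continuous_imJ.measurable.comp hx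
  have hK1 : Measurable fun q : ℍ × ℍ × ℍ => q.2.1.imK := Quaternion.continuous_imK.measurable.comp hx
  have hR2 : Measurable fun q : ℍ × ℍ × ℍ => q.2.2.re := Quaternion.continuous_re.measurable.comp hy
  have hI2 : Measurable fun q : ℍ × ℍ × ℍ => q.2.2.imI := Quaternion.continuous_imI.measurable.comp hy
  have hJ2 : Measurable fun q : ℍ × ℍ × ℍ => q.2.2.imJ := Quaternion.continuous_imJ.measurable.comp hy
  have hK2 : Measurable fun q : ℍ × ℍ × ℍ => q.2.2.imK := Quaternion.continuous_imK.measurable.comp hy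
  have e : (fun q : ℍ × ℍ × ℍ => dominator ‖q.1.im‖ q.2.1 q.2.2) = fun q =>
      ({q : ℍ × ℍ × ℍ | q.2.1.re ^ 2 + q.2.1.imI ^ 2 < 1}.indicator (fun _ => (1 : ℝ≥0∞)) q) *
      ({q : ℍ × ℍ × ℍ | q.2.2.re ^ 2 + q.2.2.imI ^ 2 < 1}.indicator (fun _ => (1 : ℝ≥0∞)) q) *
      ENNReal.ofReal (Real.exp (-(4 * (‖q.1.im‖ ^ 2 * (q.2.1.imJ ^ 2 + q.2.1.imK ^ 2 + q.2.2.imJ ^ 2 + q.2.2.imK ^ 2) +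
        ((q.2.1.imK * q.2.2.imI - q.2.1.imI * q.2.2.imK) ^ 2 + (q.2.1.imI * q.2.2.imJ - q.2.1.imJ * q.2.2.imI) ^ 2))))) := by
    funext q
    rw [dominator_def]
    simp only [Set.indicator, Set.mem_setOf_eq]
  rw [e]
  refine ((Measurable.indicator measurable_const ?_).mul (Measurable.indicator measurable_const ?_)).mul ?_
  · exact measurableSet_lt ((hR1.pow_const 2).add (hI1.pow_const 2)) measurable_const
  · exact measurableSet_lt ((hR2.pow_const 2).add (hI2.pow_const 2)) measurable_const
  · refine ENNReal.measurable_ofReal.comp (Real.measurable_exp.comp (Measurable.neg ?_))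
    exact (((hr.pow_const 2).mul ((((hJ1.pow_const 2).add (hK1.pow_const 2)).add (hJ2.pow_const 2)).add (hK2.pow_const 2))).add
      ((((hK1.mul hI2).sub (hI1.mul hK2)).pow_const 2).add (((hI1.mul hJ2).sub (hJ1.mul hI2)).pow_const 2))).const_mul _

/-- Tonelli: the product-measure integral of the dominator is the iterated one. [folklore] -/
theorem lintegral_dominator_prod_eq_iterated :
    ∫⁻ q, dominator ‖q.1.im‖ q.2.1 q.2.2 ∂(coneMeasure.prod ((volume : Measure ℍ).prod (volume : Measure ℍ))) =
      ∫⁻ a, (∫⁻ x, ∫⁻ y, dominator ‖a.im‖ x y) ∂coneMeasure := by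
  haveI := isProbabilityMeasure_coneMeasure
  rw [lintegral_prod _ measurable_dominator_triple.aemeasurable]
  refine lintegral_congr fun a => ?_
  have h2 : Measurable fun p : ℍ × ℍ => dominator ‖a.im‖ p.1 p.2 :=
    Measurable.of_uncurry_left (f := fun (b : ℍ) (p : ℍ × ℍ) => dominator ‖b.im‖ p.1 p.2) measurable_dominator_triple
  rw [lintegral_prod _ h2.aemeasurable]

/-- ★★★ The small-ball limit with the integrability hypothesis in ITERATED form
(`∫dcone(a) ∫dx ∫dy dominator ‖Im a‖ x y < ∞`, the shape of w2 g55's part V). [cite: GonzalezarroyoAltes1988] [cite: Vanbaal2001] -/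
theorem tendsto_haar_tripleBall_div_pow_four' (hV : ∫⁻ a, (∫⁻ x, ∫⁻ y, dominator ‖a.im‖ x y) ∂coneMeasure ≠ ∞) :
    Tendsto (fun t : ℝ => ((Measure.pi fun _ : Fin 3 => haarProbability (Matrix.specialUnitaryGroup (Fin 2) ℂ)) (tripleBall t)).toReal / t ^ 4)
      (𝓝[>] (0 : ℝ))
      (𝓝 (ENNReal.ofReal coneConst * (ENNReal.ofReal coneConst *
        ∫⁻ a, (∫⁻ x, ∫⁻ y, (rescaledSet 0 (axisPoint a)).indicator (1 : ℍ × ℍ → ℝ≥0∞) (x, y)) ∂coneMeasure)).toReal) :=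
  tendsto_haar_tripleBall_div_pow_four (by rwa [lintegral_dominator_prod_eq_iterated])

/-- ★ Positivity of the limit constant, iterated-hypothesis form. [folklore] -/
theorem smallBallConst_pos' (hV : ∫⁻ a, (∫⁻ x, ∫⁻ y, dominator ‖a.im‖ x y) ∂coneMeasure ≠ ∞) :
    0 < (ENNReal.ofReal coneConst * (ENNReal.ofReal coneConst *
      ∫⁻ a, (∫⁻ x, ∫⁻ y, (rescaledSet 0 (axisPoint a)).indicator (1 : ℍ × ℍ → ℝ≥0∞) (x, y)) ∂coneMeasure)).toReal :=
  smallBallConst_pos (by rwa [lintegral_dominator_prod_eq_iterated])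

/-- ★★★ **HEADLINE (modulo `hV`)**: there is `v₃′ > 0` with `Haar³{C ∈ SU(2)³ | ‖[q₀,q₁]‖, ‖[q₀,q₂]‖, ‖[q₁,q₂]‖ ≤ t} / t⁴ → v₃′` as `t → 0⁺` —
LEAD g93's small-ball shape of the exact `k = 3` zero-mode rung (limit form; power-rate remainder not claimed). [cite: GonzalezarroyoAltes1988] [cite: Vanbaal2001] -/
theorem exists_smallBall_three_limit (hV : ∫⁻ a, (∫⁻ x, ∫⁻ y, dominator ‖a.im‖ x y) ∂coneMeasure ≠ ∞) :
    ∃ v : ℝ, 0 < v ∧ Tendsto (fun t : ℝ =>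
      ((Measure.pi fun _ : Fin 3 => haarProbability (Matrix.specialUnitaryGroup (Fin 2) ℂ)) (tripleBall t)).toReal / t ^ 4) (𝓝[>] (0 : ℝ)) (𝓝 v) :=
  ⟨_, smallBallConst_pos' hV, tendsto_haar_tripleBall_div_pow_four' hV⟩

end Summit.QuantumFields.YangMills.Theorems.SwapVirialDeficit.ZeroModeGroup

end
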